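import Summits.CriticalPhenomena.PercolationContinuityZ3.Theorems.PercNearOneGluingNoHeavyLowerTailCSHDefs
import HarnessLib

/-!
# The conditioned slack hierarchy for a SET observer (CSH-set): DEFINITIONS

Definitions file (`--supports stmt-CriticalPhenomena-4576`), seat (b) V⁺-form `png-dp-vplus`, gen 12 (memo MEMO-gen12.md §3, §7 step S1 of
run/shared/lean/prim/prim-png-dp-vplus/).  No named facts, no sorries; standard axioms.  Companion of prim-hp-8's
`…NoHeavyLowerTailCSHDefs.lean` (point observer), whose linear algebra (`CSH.slForm`, `CSH.cshMarg`, …) is reused verbatim with the SLOT TYPE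
`Option V`: the slot `none` is the observer SET `O`, the slot `some u` is the vertex `u` (second observer `v`, decoys `d_j`).

THE RULE (memo §3).  The observer set `O` sees a cluster `C_u` that is conditioned to avoid a vertex set `A` through the event
  `obsEv O u A = {O ~ u} ∩ {O ≁ A}`,  `{O ~ u} = ⋃_{o∈O} {o ↔ u}`,  `{O ≁ A} = ⋂_{o∈O, a∈A} {o ↮ a}`
("the observer is killed when it touches the avoided set"); a vertex slot `w'` sees it through `{u ↔ w'}` (`slotEv`).  With this rule:
`avoidConstSet` (decoy constants `c_j(·)`, `= CSH.avoidConst` on vertex slots), `decoyListSet`, `obsConstSet` (the observers' constant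
`p = μ({O~v}∩{O≁A})/μ(v↮A)`), `covDSet` (denominator-free conditional covariance of `f(C_x)` with the slot indicators, `= CSH.covD` on vertex
slots), `cshMarginSet`, `CSHSetHolds` (CSH-set`(Y; x; D; O, v)[f] ≥ 0` for every monotone `f`), and the set pre-FKG surplus `preSurplusSet`
(slot `none`: `Σ_{a∈X} ∫_{P^O_a}(F(C_a) − F(C_c))` with the first-touched patterns `P^O_a = {O~a} ∩ ⋂_{r a' < r a}{O≁a'}`; slot `some u`:
`∫_{u↔X}(F(C_u) − F(C_c))`).  Numerics (memo §3, kit j091150): 0 violations of `CSHSetHolds` in 2.0·10⁵ set instances (levels ≤ 3).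
[cite: VandenbergHaggstromKahn2005, Thm. 1.3 (p. 6), Thm. 2.1 (p. 9)] [cite: KozmaNitzan2024, Conj. 4 (p. 32), Thm 4 (pp. 12–14)]
-/

noncomputable section

namespace Summit.CriticalPhenomena.PercolationContinuityZ3.Theorems

open MeasureTheory Set Literature.Probability.LatticeModels Literature.Probability.Percolation
open scoped Classical

namespace CSHSet

variable {V : Type*}

/-- **The set-observer event** for a cluster `C_u` conditioned to avoid `A`: `{O ~ u} ∩ {O ≁ A}`.
(transcription of the cell memo png-dp-vplus MEMO-gen12.md §3) [folklore] -/
def obsEv (O : Finset V) (u : V) (A : Set V) : Set (BondConfig V) :=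
  {ω | ∃ o ∈ O, (openGraph ω).Reachable o u} ∩ {ω | ∀ o ∈ O, ∀ a ∈ A, ¬ (openGraph ω).Reachable o a}

/-- **Slot events**: the set observer (`none`) sees `C_u` (avoiding `A`) through `obsEv O u A`, a vertex slot `w'` through `{u ↔ w'}`.
(transcription of the cell memo png-dp-vplus MEMO-gen12.md §3) [folklore] -/
def slotEv (O : Finset V) (u : V) (A : Set V) : Option V → Set (BondConfig V)
  | none => obsEv O u A
  | some w' => openConn u w'

/-- The set-observer slot event. [folklore] -/
@[simp] theorem slotEv_none (O : Finset V) (u : V) (A : Set V) : slotEv O u A none = obsEv O u A := rfl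

/-- A vertex slot event. [folklore] -/
@[simp] theorem slotEv_some (O : Finset V) (u : V) (A : Set V) (w' : V) :
    slotEv O u A (some w') = (openConn u w' : Set (BondConfig V)) := rfl

/-- `{O ~ u} ∩ {O ≁ A} ⊆ {u ↮ A}`. [folklore] -/
theorem obsEv_subset_avoid (O : Finset V) (u : V) (A : Set V) :
    obsEv O u A ⊆ {ω : BondConfig V | ∀ a ∈ A, ¬ (openGraph ω).Reachable u a} := by
  rintro ω ⟨⟨o, ho, hou⟩, h2⟩ a ha hua
  exact h2 o ho a ha (hou.trans hua)

/-- **The decoy constants with a set-observer slot**: `c(s) = μ(d ↮ A, slot s sees C_d) / μ(d ↮ A)`.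
(transcription of the cell memo png-dp-vplus MEMO-gen12.md §3) [folklore] -/
def avoidConstSet (w : Sym2 V → unitInterval) (O : Finset V) (d : V) (A : Set V) : Option V → ℝ := fun s =>
  (prodBernoulli w).real ({ω : BondConfig V | ∀ a ∈ A, ¬ (openGraph ω).Reachable d a} ∩ slotEv O d A s) /
    (prodBernoulli w).real {ω : BondConfig V | ∀ a ∈ A, ¬ (openGraph ω).Reachable d a}

/-- On a vertex slot the set constant is the point constant `CSH.avoidConst`. [folklore] -/
theorem avoidConstSet_some (w : Sym2 V → unitInterval) (O : Finset V) (d : V) (A : Set V) (u : V) :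
    avoidConstSet w O d A (some u) = CSH.avoidConst w d A u := rfl

/-- **The decoy/constant list with a set-observer slot** (decoys `d_1, …, d_k` in order, growing avoided sets).
(transcription of the cell memo png-dp-vplus MEMO-gen12.md §3) [folklore] -/
def decoyListSet (w : Sym2 V → unitInterval) (O : Finset V) : Set V → List V → List (Option V × (Option V → ℝ))
  | _, [] => []
  | A, d :: ds => (some d, avoidConstSet w O d A) :: decoyListSet w O (insert d A) ds

/-- No decoys. [folklore] -/
@[simp] theorem decoyListSet_nil (w : Sym2 V → unitInterval) (O : Finset V) (A : Set V) : decoyListSet w O A [] = [] := rfl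

/-- Unfolding the first decoy. [folklore] -/
@[simp] theorem decoyListSet_cons (w : Sym2 V → unitInterval) (O : Finset V) (A : Set V) (d : V) (ds : List V) :
    decoyListSet w O A (d :: ds) = (some d, avoidConstSet w O d A) :: decoyListSet w O (insert d A) ds := rfl

/-- The decoys of `decoyListSet w O A D` are the vertex slots of the members of `D`. [folklore] -/
theorem mem_decoyListSet (w : Sym2 V → unitInterval) (O : Finset V) :
    ∀ (A : Set V) (D : List V) (dc : Option V × (Option V → ℝ)), dc ∈ decoyListSet w O A D → ∃ d ∈ D, dc.1 = some d
  | _, [], dc, h => by simp [decoyListSet] at h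
  | A, d :: D, dc, h => by
    simp only [decoyListSet, List.mem_cons] at h
    rcases h with rfl | h
    · exact ⟨d, List.mem_cons_self, rfl⟩
    · obtain ⟨d', hd', h'⟩ := mem_decoyListSet w O (insert d A) D dc h
      exact ⟨d', List.mem_cons_of_mem d hd', h'⟩

/-- **The observers' constant** `p = μ({O ~ v} ∩ {O ≁ A}) / μ(v ↮ A)` (set observer `O`, vertex observer `v`).
(transcription of the cell memo png-dp-vplus MEMO-gen12.md §3) [folklore] -/
def obsConstSet (w : Sym2 V → unitInterval) (O : Finset V) (v : V) (A : Set V) : ℝ :=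
  (prodBernoulli w).real (obsEv O v A) / (prodBernoulli w).real {ω : BondConfig V | ∀ a ∈ A, ¬ (openGraph ω).Reachable v a}

/-- **The denominator-free conditional covariance with the slot indicators**, `D = {x ↮ Y}`:
`covDSet(f)(s) = μ(D)·∫_{D ∩ slot s} f(C_x) − (∫_D f(C_x))·μ(D ∩ slot s)` (`= CSH.covD` on vertex slots).
(transcription of the cell memo png-dp-vplus MEMO-gen12.md §3) [folklore] -/
def covDSet (w : Sym2 V → unitInterval) (x : V) (Y : Set V) (f : Set (Sym2 V) → ℝ) (O : Finset V) : Option V → ℝ := fun s =>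
  (prodBernoulli w).real {ω : BondConfig V | ∀ y ∈ Y, ¬ (openGraph ω).Reachable x y} *
      (∫ ω in {ω : BondConfig V | ∀ y ∈ Y, ¬ (openGraph ω).Reachable x y} ∩ slotEv O x Y s,
        f (openEdgeCluster ω x) ∂(prodBernoulli w)) -
    (∫ ω in {ω : BondConfig V | ∀ y ∈ Y, ¬ (openGraph ω).Reachable x y}, f (openEdgeCluster ω x) ∂(prodBernoulli w)) *
      (prodBernoulli w).real ({ω : BondConfig V | ∀ y ∈ Y, ¬ (openGraph ω).Reachable x y} ∩ slotEv O x Y s)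

/-- On a vertex slot `covDSet` is `CSH.covD`. [folklore] -/
theorem covDSet_some (w : Sym2 V → unitInterval) (x : V) (Y : Set V) (f : Set (Sym2 V) → ℝ) (O : Finset V) (u : V) :
    covDSet w x Y f O (some u) = CSH.covD w x Y f u := rfl

/-- **The margin of CSH-set`(Y; x; D; O, v)[f]`** (the level form of prim-hp-8 with slots `none` = `O`, `some v`, `some d_j`).
(transcription of the cell memo png-dp-vplus MEMO-gen12.md §3) [folklore] -/
def cshMarginSet (w : Sym2 V → unitInterval) (x : V) (Y : Set V) (D : List V) (O : Finset V) (v : V)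
    (f : Set (Sym2 V) → ℝ) : ℝ :=
  CSH.cshMarg (decoyListSet w O (insert x Y) D) (obsConstSet w O v (insert x Y ∪ {d | d ∈ D})) none (some v) (covDSet w x Y f O)

/-- **CSH-set`(Y; x; D; O, v)`**: the margin is nonnegative for every monotone functional of the open edge cluster of the owner.
(transcription of the cell memo png-dp-vplus MEMO-gen12.md §3) [folklore] -/
def CSHSetHolds (w : Sym2 V → unitInterval) (x : V) (Y : Set V) (D : List V) (O : Finset V) (v : V) : Prop :=
  ∀ f : Set (Sym2 V) → ℝ, Monotone f → 0 ≤ cshMarginSet w x Y D O v f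

/-- **The set pre-FKG surplus as a slot function** (benchmark relay `c`, rank `r`): slot `none` is
`Δ^r_O(X) = Σ_{a∈X} ∫_{P^O_a} (F(C_a) − F(C_c))`, `P^O_a = {O~a} ∩ ⋂_{a'∈X, r a' < r a} {O≁a'}`; slot `some u` is
`Δ_u(X) = ∫_{u ↔ X} (F(C_u) − F(C_c))`. (transcription of the cell memo png-dp-vplus MEMO-gen12.md §0.1) [folklore] -/
def preSurplusSet (w : Sym2 V → unitInterval) (O X : Finset V) (r : V → ℕ) (F : Set V → ℝ) (c : V) : Option V → ℝ
  | none => ∑ a ∈ X, ∫ ω in {ω : BondConfig V | ∃ o ∈ O, (openGraph ω).Reachable o a} ∩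
        {ω | ∀ a' ∈ X, r a' < r a → ∀ o ∈ O, ¬ (openGraph ω).Reachable o a'},
        (F (openCluster ω a) - F (openCluster ω c)) ∂(prodBernoulli w)
  | some u => ∫ ω in ⋃ a ∈ X, openConn u a, (F (openCluster ω u) - F (openCluster ω c)) ∂(prodBernoulli w)

/-- The vertex slots of the set pre-FKG surplus. [folklore] -/
@[simp] theorem preSurplusSet_some (w : Sym2 V → unitInterval) (O X : Finset V) (r : V → ℕ) (F : Set V → ℝ) (c u : V) :
    preSurplusSet w O X r F c (some u) =
      ∫ ω in ⋃ a ∈ X, openConn u a, (F (openCluster ω u) - F (openCluster ω c)) ∂(prodBernoulli w) := rfl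

/-- The set slot of the set pre-FKG surplus. [folklore] -/
@[simp] theorem preSurplusSet_none (w : Sym2 V → unitInterval) (O X : Finset V) (r : V → ℕ) (F : Set V → ℝ) (c : V) :
    preSurplusSet w O X r F c none = ∑ a ∈ X, ∫ ω in {ω : BondConfig V | ∃ o ∈ O, (openGraph ω).Reachable o a} ∩
        {ω | ∀ a' ∈ X, r a' < r a → ∀ o ∈ O, ¬ (openGraph ω).Reachable o a'},
        (F (openCluster ω a) - F (openCluster ω c)) ∂(prodBernoulli w) := rfl

end CSHSet

end Summit.CriticalPhenomena.PercolationContinuityZ3.Theorems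

end
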